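import Summits.CriticalPhenomena.PercolationContinuityZ3.Theorems.PercNearOneGluingNoHeavyLowerTailSunflowerLinkedCurrency
import HarnessLib

/-!
# `NoHeavyLowerTail` (crux stmt-CriticalPhenomena-4575), abstract sunflower cubic: (RES0′) for every number of
# petals on PURE families — every petal at the floor of one of the two faces

Support file (seat `prim-ineq-prove-1` gen 60; `--supports stmt-CriticalPhenomena-4575`).  No `sorry`, no named facts.
Memo: run/shared/lean/prim/prim-ineq-prove-1/FINDING-HFACE-prove1-g60.md §3.

Two-linked-systems model (`…SunflowerLinkedCurrency`, `…SunflowerTwoCoinPairwiseModel`): coins `τ, σ, s`, floors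
`α₀₀ ≤ α₀₁ ≤ α₁₁`, petals `(y,k,g,h)`, `Ȳ = (1−s)y + sk`, `H = (1−σ)g + σh`, `G = c₀ + τ(1−σ)Ȳ + s(1−τ)H`,
`g* = G(floor)`, `a = G(full)`.  A petal is `H`-FLOOR if `g = α₀₁, h = α₁₁` (all its excess is on the `Ȳ` face: x-hubs,
k-hubs, cheap-`y` petals) and `Ȳ`-FLOOR if `y = α₀₀, k = α₀₁` (then `g = α₀₁` by the link `g ≤ k`: the pure `h`-petals).
A family is PURE if every petal is one or the other.  Pure families are the extreme case of the two-coin INcompatibility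
that Theorem Y (`res0_pairwise`) cannot handle: an `H`-floor petal and a `Ȳ`-floor petal are never compatible, and the
product of the two classes exceeds the two-face potential by the full cross term.

**`res0_pure`**: every pure family satisfies (RES0′) `∏ G_j ≤ (g*)^(n−1)·a`, for every `n`, from the `Ȳ`-face budget
`∏ Ȳ_j ≤ b_Ȳ^(n−1)` and the `h`-cell budget `∏ h_j ≤ α₁₁^(n−1)` alone, for every `c₀ ≥ τσ`.  Proof: one coin on each
class (`rfun_anti`), then the cross term `ε_Y(1/b_Ȳ − 1)·ε_h(1/α₁₁ − 1)` is paid by the unused `g`-cell capacity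
`ε_g(1/α₀₁ − 1)`, i.e. by the structural inequality `τ(1−σ)(1 − b_Ȳ)·σ(1 − α₁₁) ≤ (1−σ)(1 − α₀₁)·g*`, which holds
exactly because `g* ≥ τσ + τ(1−σ)b_Ȳ` (`pure_cross_le`).  An all-`n` class ACROSS the two-coin diagonal with both
classes non-trivial and mutually incompatible: it contains every `{x-hubs, k-hubs, cheap-y cloud} ∪ {h-petals}` family
(gen 52's tight pair `{hub, h-petal}` is its `n = 2`, `g = α₀₁` instance); not covered by `res0_pairwise`,
`res0_comonotone`, `res0_classK` (`h ≤ k`), `res0_hfloor` or `res0_Wdominant`.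
-/

noncomputable section

namespace Summit.CriticalPhenomena.PercolationContinuityZ3.Theorems.SunflowerPartition

namespace SafeCalc

namespace LinkedCurrency

open Finset

variable {κ : Type*}

/-- **The cross term of a pure family is paid by the unused `g`-cell.**  With `p = τ(1−σ)`, `q = s(1−τ)`,
`g* = c₀ + p b_Ȳ + q b_H ≥ τσ + p b_Ȳ` (`c₀ ≥ τσ`, `q b_H ≥ 0`), `0 ≤ b_Ȳ`, `α₀₁ ≤ α₁₁ ≤ 1`, `0 ≤ σ ≤ 1`:
`p(1 − b_Ȳ)·σ(1 − α₁₁) ≤ (1 − σ)(1 − α₀₁)·g*`. [this work] -/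
theorem pure_cross_le {τ σ bY α01 α11 gst : ℝ} (hτ0 : 0 ≤ τ) (hσ0 : 0 ≤ σ) (hσ1 : σ ≤ 1) (hbY0 : 0 ≤ bY)
    (h11 : α01 ≤ α11) (hα1 : α11 ≤ 1) (hg : τ * σ + τ * (1 - σ) * bY ≤ gst) :
    τ * (1 - σ) * (1 - bY) * (σ * (1 - α11)) ≤ (1 - σ) * (1 - α01) * gst := by
  have h1 : (1 - σ) * (1 - α01) * (τ * σ + τ * (1 - σ) * bY) ≤ (1 - σ) * (1 - α01) * gst :=
    mul_le_mul_of_nonneg_left hg (mul_nonneg (by linarith) (by linarith))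
  have h2 : τ * (1 - σ) * (1 - bY) * (σ * (1 - α11)) ≤ (1 - σ) * (1 - α01) * (τ * σ) := by
    have e : (1 - σ) * (1 - α01) * (τ * σ) - τ * (1 - σ) * (1 - bY) * (σ * (1 - α11)) =
        τ * σ * (1 - σ) * ((α11 - α01) + bY * (1 - α11)) := by ring
    nlinarith [mul_nonneg (mul_nonneg (mul_nonneg hτ0 hσ0) (by linarith : (0:ℝ) ≤ 1 - σ))
      (add_nonneg (by linarith : (0:ℝ) ≤ α11 - α01) (mul_nonneg hbY0 (by linarith : (0:ℝ) ≤ 1 - α11)))]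
  have h3 : 0 ≤ (1 - σ) * (1 - α01) * (τ * (1 - σ) * bY) :=
    mul_nonneg (mul_nonneg (by linarith) (by linarith)) (mul_nonneg (mul_nonneg hτ0 (by linarith)) hbY0)
  nlinarith

/-- One coin for a class whose value factors are `1 + a_j` with `1 + a_j/ε = u_j` and `∏ u_j ≤ U`: then
`∏ (1 + a_j) ≤ 1 + ε (U − 1)` (`0 < ε ≤ 1`, `a_j ≥ 0`). [this work] -/
theorem one_coin_class [DecidableEq κ] (S : Finset κ) (a : κ → ℝ) (ha : ∀ j ∈ S, 0 ≤ a j) {ε U : ℝ}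
    (hε : 0 < ε) (hε1 : ε ≤ 1) (hU : ∏ j ∈ S, (1 + a j / ε) ≤ U) :
    ∏ j ∈ S, (1 + a j) ≤ 1 + ε * (U - 1) := by
  have h1 := rfun_anti S a ha hε hε1
  have h2 : ∏ j ∈ S, (1 + a j / 1) = ∏ j ∈ S, (1 + a j) := prod_congr rfl fun j _ => by rw [div_one]
  rw [h2, one_mul] at h1
  have h3 : ε * (∏ j ∈ S, (1 + a j / ε) - 1) ≤ ε * (U - 1) := mul_le_mul_of_nonneg_left (by linarith) hε.le
  linarith

set_option maxHeartbeats 400000 in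
/-- **(RES0′) ∀n ON PURE FAMILIES, from the `Ȳ`-face and `h`-cell budgets.**  Coins `0 < τ < 1`, `0 ≤ σ < 1`,
`0 < s ≤ 1`; floors `0 < α₀₀ ≤ α₀₁ ≤ α₁₁ ≤ 1`; any `c₀ ≥ τσ`.  Petals `j ∈ S` with `α₀₀ ≤ y_j`, `α₀₁ ≤ k_j`,
`y_j ≤ 1`, `k_j ≤ 1`, `α₁₁ ≤ h_j`, each PURE: either `H`-floor (`g_j = α₀₁ ∧ h_j = α₁₁`) or `Ȳ`-floor
(`y_j = α₀₀ ∧ k_j = α₀₁ ∧ g_j = α₀₁`).  Budgets: `∏ ((1−s)y_j + s k_j) ≤ ((1−s)α₀₀ + sα₀₁)^(|S|−1)` and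
`∏ h_j ≤ α₁₁^(|S|−1)`.  Then `∏ G_j ≤ (g*)^(|S|−1)·a`. [this work] -/
theorem res0_pure [DecidableEq κ] {τ σ s α00 α01 α11 c0 : ℝ} (hτ0 : 0 < τ) (hτ1 : τ < 1) (hσ0 : 0 < σ)
    (hσ1 : σ < 1) (hs0 : 0 < s) (hs1 : s ≤ 1) (hα0 : 0 < α00) (h01 : α00 ≤ α01) (h11 : α01 ≤ α11) (hα1 : α11 ≤ 1)
    (hc0 : τ * σ ≤ c0)
    (S : Finset κ) (hS : S.Nonempty) (y k gc h : κ → ℝ)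
    (hy : ∀ j ∈ S, α00 ≤ y j) (hk : ∀ j ∈ S, α01 ≤ k j) (hh : ∀ j ∈ S, α11 ≤ h j)
    (hpure : ∀ j ∈ S, (gc j = α01 ∧ h j = α11) ∨ (y j = α00 ∧ k j = α01 ∧ gc j = α01))
    (hBY : ∏ j ∈ S, ((1 - s) * y j + s * k j) ≤ ((1 - s) * α00 + s * α01) ^ (S.card - 1))
    (hBh : ∏ j ∈ S, h j ≤ α11 ^ (S.card - 1)) :
    ∏ j ∈ S, (c0 + τ * (1 - σ) * ((1 - s) * y j + s * k j) + s * (1 - τ) * ((1 - σ) * gc j + σ * h j)) ≤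
      (c0 + τ * (1 - σ) * ((1 - s) * α00 + s * α01) + s * (1 - τ) * ((1 - σ) * α01 + σ * α11)) ^ (S.card - 1) *
        (c0 + τ * (1 - σ) + s * (1 - τ)) := by
  have hτ1' : 0 < 1 - τ := sub_pos.2 hτ1
  have hσ1' : 0 < 1 - σ := sub_pos.2 hσ1
  have hs1' : 0 ≤ 1 - s := sub_nonneg.2 hs1
  have hα01 : 0 < α01 := lt_of_lt_of_le hα0 h01
  have hα11 : 0 < α11 := lt_of_lt_of_le hα01 h11
  obtain ⟨p, hp⟩ : ∃ e : ℝ, e = τ * (1 - σ) := ⟨_, rfl⟩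
  obtain ⟨q, hq⟩ : ∃ e : ℝ, e = s * (1 - τ) := ⟨_, rfl⟩
  simp only [← hp, ← hq]
  have hp0 : 0 < p := by rw [hp]; exact mul_pos hτ0 hσ1'
  have hq0 : 0 < q := by rw [hq]; exact mul_pos hs0 hτ1'
  obtain ⟨bY, hbY⟩ : ∃ e : ℝ, e = (1 - s) * α00 + s * α01 := ⟨_, rfl⟩
  obtain ⟨bH, hbH⟩ : ∃ e : ℝ, e = (1 - σ) * α01 + σ * α11 := ⟨_, rfl⟩
  rw [← hbY] at hBY ⊢
  rw [← hbH]
  have hbY0 : 0 < bY := by rw [hbY]; nlinarith [mul_nonneg hs1' hα0.le, mul_pos hs0 hα01]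
  have hbY1 : bY ≤ 1 := by rw [hbY]; nlinarith [h01, h11, hα1]
  have hbH0 : 0 < bH := by rw [hbH]; nlinarith [mul_pos hσ1' hα01, mul_nonneg hσ0.le hα11.le]
  -- the floor value g* and the two masses
  obtain ⟨g, hgdef⟩ : ∃ e : ℝ, e = c0 + p * bY + q * bH := ⟨_, rfl⟩
  rw [← hgdef]
  have hgτ : τ * σ + τ * (1 - σ) * bY ≤ g := by
    rw [hgdef, ← hp]; nlinarith [mul_pos hq0 hbH0]
  have hgpos : 0 < g := by nlinarith [mul_pos hp0 hbY0, mul_nonneg hτ0.le hσ0.le]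
  have hgne : g ≠ 0 := hgpos.ne'
  obtain ⟨εY, hεYd⟩ : ∃ e : ℝ, e = p * bY / g := ⟨_, rfl⟩
  obtain ⟨εh, hεhd⟩ : ∃ e : ℝ, e = q * σ * α11 / g := ⟨_, rfl⟩
  have hεY0 : 0 < εY := by rw [hεYd]; exact div_pos (mul_pos hp0 hbY0) hgpos
  have hεY1 : εY ≤ 1 := by
    rw [hεYd, div_le_one hgpos, hgdef]; nlinarith [mul_pos hq0 hbH0, mul_nonneg hτ0.le hσ0.le]
  have hεh0 : 0 < εh := by rw [hεhd]; exact div_pos (mul_pos (mul_pos hq0 hσ0) hα11) hgpos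
  have hεh1 : εh ≤ 1 := by
    rw [hεhd, div_le_one hgpos, hgdef, hbH]
    nlinarith [mul_pos hp0 hbY0, mul_nonneg hτ0.le hσ0.le, mul_nonneg (mul_nonneg hq0.le hσ1'.le) hα01.le,
      mul_nonneg (mul_nonneg hq0.le hσ0.le) hα11.le, mul_le_mul_of_nonneg_left hα1 (mul_nonneg hq0.le hσ0.le)]
  -- the two classes
  obtain ⟨S1, hS1⟩ : ∃ T : Finset κ, T = S.filter (fun j => gc j = α01 ∧ h j = α11) := ⟨_, rfl⟩
  obtain ⟨S2, hS2⟩ : ∃ T : Finset κ, T = S.filter (fun j => ¬ (gc j = α01 ∧ h j = α11)) := ⟨_, rfl⟩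
  have hS12 : ∀ f : κ → ℝ, ∏ j ∈ S, f j = (∏ j ∈ S1, f j) * ∏ j ∈ S2, f j := fun f => by
    rw [hS1, hS2]; exact (prod_filter_mul_prod_filter_not S _ f).symm
  have hcard12 : S1.card + S2.card = S.card := by
    rw [hS1, hS2]; exact Finset.card_filter_add_card_filter_not _
  have hS1sub : S1 ⊆ S := by rw [hS1]; exact filter_subset _ _
  have hS2sub : S2 ⊆ S := by rw [hS2]; exact filter_subset _ _
  have hS1p : ∀ j ∈ S1, gc j = α01 ∧ h j = α11 := fun j hj => by
    rw [hS1] at hj; exact (mem_filter.1 hj).2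
  have hS2p : ∀ j ∈ S2, y j = α00 ∧ k j = α01 ∧ gc j = α01 := fun j hj => by
    rw [hS2] at hj
    have h1 := mem_filter.1 hj
    rcases hpure j h1.1 with h2 | h2
    · exact absurd h2 h1.2
    · exact h2
  -- class-1 excess a_j = p (Ȳ_j − bY)/g, class-2 excess e_j = q σ (h_j − α11)/g
  obtain ⟨a, ha⟩ : ∃ f : κ → ℝ, f = fun j => p * ((1 - s) * y j + s * k j - bY) / g := ⟨_, rfl⟩
  have haj : ∀ j, a j = p * ((1 - s) * y j + s * k j - bY) / g := fun j => by rw [ha]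
  have hYge : ∀ j ∈ S, bY ≤ (1 - s) * y j + s * k j := fun j hj => by
    rw [hbY]; nlinarith [mul_le_mul_of_nonneg_left (hy j hj) hs1', mul_le_mul_of_nonneg_left (hk j hj) hs0.le]
  have ha0 : ∀ j ∈ S1, 0 ≤ a j := fun j hj => by
    rw [haj]; exact div_nonneg (mul_nonneg hp0.le (sub_nonneg.2 (hYge j (hS1sub hj)))) hgpos.le
  obtain ⟨e, he⟩ : ∃ f : κ → ℝ, f = fun j => q * σ * (h j - α11) / g := ⟨_, rfl⟩
  have hej : ∀ j, e j = q * σ * (h j - α11) / g := fun j => by rw [he]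
  have he0 : ∀ j ∈ S2, 0 ≤ e j := fun j hj => by
    rw [hej]; exact div_nonneg (mul_nonneg (mul_nonneg hq0.le hσ0.le) (sub_nonneg.2 (hh j (hS2sub hj)))) hgpos.le
  -- factorisations of G_j on the two classes
  have hG1 : ∀ j ∈ S1, c0 + p * ((1 - s) * y j + s * k j) + q * ((1 - σ) * gc j + σ * h j) = g * (1 + a j) := by
    intro j hj
    obtain ⟨hg1, hh1⟩ := hS1p j hj
    have e1 : g * a j = p * ((1 - s) * y j + s * k j - bY) := by rw [haj]; field_simp
    rw [hg1, hh1]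
    linear_combination (-1 : ℝ) * e1 - hgdef - q * hbH
  have hG2 : ∀ j ∈ S2, c0 + p * ((1 - s) * y j + s * k j) + q * ((1 - σ) * gc j + σ * h j) = g * (1 + e j) := by
    intro j hj
    obtain ⟨hy2, hk2, hg2⟩ := hS2p j hj
    have e1 : g * e j = q * σ * (h j - α11) := by rw [hej]; field_simp
    rw [hy2, hk2, hg2]
    linear_combination (-1 : ℝ) * e1 - hgdef - q * hbH - p * hbY
  -- the Ȳ-face budget seen by class 1 (class-2 petals sit at the face floor): X1 ≤ 1/bY
  have hcard : 1 ≤ S.card := card_pos.2 hS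
  have hratioY : ∏ j ∈ S, (((1 - s) * y j + s * k j) / bY) ≤ 1 / bY := by
    rw [prod_div_distrib, prod_const, div_le_div_iff₀ (pow_pos hbY0 _) hbY0, one_mul,
      show bY ^ S.card = bY ^ (S.card - 1) * bY by
        conv_lhs => rw [show S.card = (S.card - 1) + 1 by omega, pow_succ]]
    exact mul_le_mul_of_nonneg_right hBY hbY0.le
  have hX1 : ∏ j ∈ S1, (1 + a j / εY) ≤ 1 / bY := by
    have e1 : ∀ j ∈ S1, 1 + a j / εY = ((1 - s) * y j + s * k j) / bY := fun j _ => by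
      rw [haj, hεYd]; field_simp; ring
    rw [prod_congr rfl e1]
    have e2 : ∏ j ∈ S2, (((1 - s) * y j + s * k j) / bY) = 1 := by
      refine prod_eq_one fun j hj => ?_
      obtain ⟨hy2, hk2, _⟩ := hS2p j hj
      rw [hy2, hk2, ← hbY, div_self hbY0.ne']
    have e3 := hS12 (fun j => ((1 - s) * y j + s * k j) / bY)
    rw [e2, mul_one] at e3
    rw [← e3]; exact hratioY
  -- the h-cell budget seen by class 2: R2 ≤ 1/α11
  have hratioh : ∏ j ∈ S, (h j / α11) ≤ 1 / α11 := by
    rw [prod_div_distrib, prod_const, div_le_div_iff₀ (pow_pos hα11 _) hα11, one_mul,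
      show α11 ^ S.card = α11 ^ (S.card - 1) * α11 by
        conv_lhs => rw [show S.card = (S.card - 1) + 1 by omega, pow_succ]]
    exact mul_le_mul_of_nonneg_right hBh hα11.le
  have hR2 : ∏ j ∈ S2, (1 + e j / εh) ≤ 1 / α11 := by
    have e1 : ∀ j ∈ S2, 1 + e j / εh = h j / α11 := fun j _ => by
      rw [hej, hεhd]; field_simp; ring
    rw [prod_congr rfl e1]
    have e2 : ∏ j ∈ S1, (h j / α11) = 1 := by
      refine prod_eq_one fun j hj => ?_
      rw [(hS1p j hj).2, div_self hα11.ne']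
    have e3 := hS12 (fun j => h j / α11)
    rw [e2, one_mul] at e3
    rw [← e3]; exact hratioh
  -- one coin on each class
  have hP1 := one_coin_class S1 a ha0 hεY0 hεY1 hX1
  have hP2 := one_coin_class S2 e he0 hεh0 hεh1 hR2
  have hP1pos : 0 ≤ ∏ j ∈ S1, (1 + a j) := prod_nonneg fun j hj => by linarith [ha0 j hj]
  have hP2pos : 0 ≤ ∏ j ∈ S2, (1 + e j) := prod_nonneg fun j hj => by linarith [he0 j hj]
  -- the endgame: g (1 + εY(1/bY − 1))(1 + εh(1/α11 − 1)) ≤ c0 + p + q  (cross term ≤ unused g-cell)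
  have hcross := pure_cross_le hτ0.le hσ0.le hσ1.le hbY0.le h11 hα1 hgτ
  have hkey : g * ((1 + εY * (1 / bY - 1)) * (1 + εh * (1 / α11 - 1))) ≤ c0 + p + q := by
    have e1 : g * (1 + εY * (1 / bY - 1)) = c0 + p + q * bH := by
      rw [hεYd]; field_simp; rw [hgdef]; ring
    have e2 : (c0 + p + q * bH) * (1 + εh * (1 / α11 - 1)) =
        c0 + p + q * bH + (c0 + p + q * bH) * (q * σ * (1 - α11)) / g := by
      rw [hεhd]; field_simp
    rw [← mul_assoc, e1, e2]
    have e3 : (c0 + p + q * bH) * (q * σ * (1 - α11)) / g ≤ q * (1 - bH) := by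
      rw [div_le_iff₀ hgpos]
      have e4 : c0 + p + q * bH = g + p * (1 - bY) := by rw [hgdef]; ring
      rw [e4]
      -- (g + p(1−bY)) q σ (1−α11) ≤ q (1−bH) g  ⟸  p(1−bY)σ(1−α11) ≤ (1−σ)(1−α01) g
      have e5 : q * (1 - bH) * g - (g + p * (1 - bY)) * (q * σ * (1 - α11)) =
          q * ((1 - σ) * (1 - α01) * g - p * (1 - bY) * (σ * (1 - α11))) := by rw [hbH]; ring
      have hcross' : p * (1 - bY) * (σ * (1 - α11)) ≤ (1 - σ) * (1 - α01) * g := by rw [hp]; exact hcross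
      have e6 := mul_nonneg hq0.le (sub_nonneg.2 hcross')
      linarith
    linarith
  -- assemble
  rw [hS12, prod_congr rfl hG1, prod_congr rfl hG2, prod_const_mul', prod_const_mul']
  have hpow : g ^ S1.card * (∏ j ∈ S1, (1 + a j)) * (g ^ S2.card * ∏ j ∈ S2, (1 + e j)) =
      g ^ (S.card - 1) * (g * ((∏ j ∈ S1, (1 + a j)) * ∏ j ∈ S2, (1 + e j))) := by
    have : g ^ S1.card * g ^ S2.card = g ^ (S.card - 1) * g := by
      rw [← pow_add, hcard12]
      conv_lhs => rw [show S.card = (S.card - 1) + 1 by omega, pow_succ]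
    calc g ^ S1.card * (∏ j ∈ S1, (1 + a j)) * (g ^ S2.card * ∏ j ∈ S2, (1 + e j))
        = (g ^ S1.card * g ^ S2.card) * ((∏ j ∈ S1, (1 + a j)) * ∏ j ∈ S2, (1 + e j)) := by ring
      _ = _ := by rw [this]; ring
  rw [hpow]
  refine mul_le_mul_of_nonneg_left ?_ (by positivity)
  have hprod : (∏ j ∈ S1, (1 + a j)) * ∏ j ∈ S2, (1 + e j) ≤
      (1 + εY * (1 / bY - 1)) * (1 + εh * (1 / α11 - 1)) :=
    mul_le_mul hP1 hP2 hP2pos (by linarith)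
  calc g * ((∏ j ∈ S1, (1 + a j)) * ∏ j ∈ S2, (1 + e j))
      ≤ g * ((1 + εY * (1 / bY - 1)) * (1 + εh * (1 / α11 - 1))) := mul_le_mul_of_nonneg_left hprod hgpos.le
    _ ≤ c0 + p + q := hkey

end LinkedCurrency

end SafeCalc

end Summit.CriticalPhenomena.PercolationContinuityZ3.Theorems.SunflowerPartition
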